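import Mathlib
import Summits.CriticalPhenomena.CardyFormulaZ2.Theorems.CardySelfRefinementDefs
import Literature.Topology.PlaneTopology.ArcGluing
import HarnessLib

/-!
# Boundary-layer surgery, topology brick (S4), part II: the cross-cut through a no-room edge

Helper file of the registered stub `stub_layerLocalModification` (the deterministic
boundary-layer surgery) of the line `monotone-product-coordinates` (crux
`stmt-CriticalPhenomena-10269`, `…Theses.CardySelfRefinement.GradientComparability`).  Step (S4)
of the layer surgery (the cell-contact lemma, file `…StubLayerContact.lean`) cuts the open quad
`[Q]°` along the cross-cut `β_ε`: two paths `γ₁, γ₂` leaving the point `m` of a lattice edge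
perpendicularly into the two open cells beside it, each stopped at its first exit from `[Q]°`.
This file contains the configuration-free plane geometry of that step:
`isSimpleArc_twoPaths_crosscut` (registered helper) — the union of the two stopped paths is a
simple arc with all the properties required by the dead-finger lemma `quad_bridge_deadFinger`
(interior in the open set, meeting a forbidden set `X` at most at `m`, straight across `m` in a
small ball: inside `B(m, ρ)` it is the diameter perpendicular to the edge direction `v`, which
rests on the description of the line orthogonal to `v` as `m + ℝ · i v`).

No percolation, no named fact.
-/

noncomputable section

namespace Summit.CriticalPhenomena.CardyFormulaZ2.Theorems.CardySelfRefinement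

open scoped Topology
open Filter Set MeasureTheory
open Literature.Probability.LatticeModels Literature.Probability.Percolation
open Literature.Probability.Percolation.QuadCrossing
open Summit.CriticalPhenomena.CardyFormulaZ2.Theses.CardySelfRefinement
open Literature.Topology.PlaneTopology

/-! ## Inner products with the perpendicular direction -/

/-- A real multiple of `i v` is orthogonal to `v`. -/
theorem inner_ofReal_mul_I_mul (r : ℝ) (v : ℂ) : inner ℝ ((r : ℂ) * (Complex.I * v)) v = 0 := by
  rw [Complex.inner]
  simp only [map_mul, Complex.conj_ofReal, Complex.conj_I, Complex.mul_re, Complex.mul_im,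
    Complex.ofReal_re, Complex.ofReal_im, Complex.neg_re, Complex.neg_im, Complex.I_re,
    Complex.I_im, Complex.conj_re, Complex.conj_im]
  ring

/-- In the plane, a vector orthogonal to `v ≠ 0` is a real multiple of `i v`. -/
theorem exists_eq_ofReal_mul_I_mul_of_inner_eq_zero {v w : ℂ} (hv : v ≠ 0)
    (h : inner ℝ w v = 0) : ∃ θ : ℝ, w = (θ : ℂ) * (Complex.I * v) ∧ ‖w‖ = |θ| * ‖v‖ := by
  set a : ℂ := w / v with ha
  have hw : w = a * v := by rw [ha]; field_simp
  have hin : inner ℝ w v = Complex.normSq v * a.re := by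
    rw [hw, Complex.inner, map_mul]
    have : v * ((starRingEnd ℂ) a * (starRingEnd ℂ) v) =
        (Complex.normSq v : ℂ) * (starRingEnd ℂ) a := by
      rw [← Complex.mul_conj]; ring
    rw [this, Complex.re_ofReal_mul, Complex.conj_re]
  have hare : a.re = 0 := by
    rcases mul_eq_zero.1 (hin.symm.trans h) with h' | h'
    · exact absurd (Complex.normSq_eq_zero.1 h') hv
    · exact h'
  obtain ⟨θ, hθ⟩ : ∃ θ : ℝ, θ = a.im := ⟨_, rfl⟩
  have haI : a = (θ : ℂ) * Complex.I := Complex.ext (by simp [hare, hθ]) (by simp [hθ])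
  refine ⟨θ, by rw [hw, haI]; ring, ?_⟩
  rw [hw, haI, norm_mul, norm_mul, Complex.norm_real, Complex.norm_I, Real.norm_eq_abs, mul_one]

/-! ## The cross-cut assembled from two stopped paths -/

/-- **The cross-cut through a no-room edge** (brick (S4), part II, of the boundary-layer surgery
`stub_layerLocalModification`; registered helper).  Let `γ₁, γ₂` be continuous injective paths
on `[0, 1]` leaving `m` straight along `± i v` (`γ₁ t = m + c t · i v`, `γ₂ t = m - c t · i v`
for `t ≤ t₀`) and staying at distance `≥ R` from `m` afterwards, with disjoint open images
`γᵢ (0, 1)` both missing the set `X`; let `τᵢ ∈ (0, 1)` be such that `γᵢ [0, τᵢ)` lies in the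
open set `U`.  Then `β = γ₂ [0, τ₂] ∪ γ₁ [0, τ₁]` is a simple arc from `γ₂ τ₂` to `γ₁ τ₁`, its
other points lie in `U`, it meets `X` at most at `m`, and inside some ball `B(m, ρ) ⊆ U` it is
the diameter perpendicular to `v`. -/
theorem isSimpleArc_twoPaths_crosscut : ∀ (U X : Set ℂ) (γ₁ γ₂ : ℝ → ℂ) (m v : ℂ) (c t₀ R τ₁ τ₂ : ℝ), IsOpen U → v ≠ 0 → 0 < c → 0 < t₀ → 0 < R → ContinuousOn γ₁ (Set.Icc 0 1) → ContinuousOn γ₂ (Set.Icc 0 1) → Set.InjOn γ₁ (Set.Icc 0 1) → Set.InjOn γ₂ (Set.Icc 0 1) → (∀ t ∈ Set.Icc 0 t₀, γ₁ t = m + ((c * t : ℝ) : ℂ) * (Complex.I * v)) → (∀ t ∈ Set.Icc 0 t₀, γ₂ t = m - ((c * t : ℝ) : ℂ) * (Complex.I * v)) → (∀ t ∈ Set.Icc t₀ 1, R ≤ dist (γ₁ t) m) → (∀ t ∈ Set.Icc t₀ 1, R ≤ dist (γ₂ t) m) → Disjoint (γ₁ '' Set.Ioo 0 1) (γ₂ ''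 Set.Ioo 0 1) → Disjoint (γ₁ '' Set.Ioo 0 1 ∪ γ₂ '' Set.Ioo 0 1) X → τ₁ ∈ Set.Ioo (0 : ℝ) 1 → τ₂ ∈ Set.Ioo (0 : ℝ) 1 → Set.MapsTo γ₁ (Set.Ico 0 τ₁) U → Set.MapsTo γ₂ (Set.Ico 0 τ₂) U → Literature.Topology.PlaneTopology.IsSimpleArc (γ₂ '' Set.Icc 0 τ₂ ∪ γ₁ '' Set.Icc 0 τ₁) (γ₂ τ₂) (γ₁ τ₁) ∧ (γ₂ '' Set.Icc 0 τ₂ ∪ γ₁ '' Set.Icc 0 τ₁) \ {γ₂ τ₂, γ₁ τ₁} ⊆ U ∧ (γ₂ '' Set.Icc 0 τ₂ ∪ γ₁ '' Set.Icc 0 τ₁) ∩ X ⊆ {m} ∧ ∃ ρ : ℝ, 0 < ρ ∧ Metric.ball m ρ ⊆ U ∧ (γ₂ '' Set.Icc 0 τ₂ ∪ γ₁ '' Set.Icc 0 τ₁) ∩ Metric.ball m ρ = Metric.ball m ρ ∩ {z | inner ℝ (z - m) v = 0} := by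
  intro U X γ₁ γ₂ m v c t₀ R τ₁ τ₂ hU hv hc ht₀ hR hγ₁ hγ₂ hinj₁ hinj₂ hs₁ hs₂ hR₁ hR₂ hdisj hX
    hτ₁ hτ₂ hU₁ hU₂
  have h10 : γ₁ 0 = m := by rw [hs₁ 0 ⟨le_rfl, ht₀.le⟩]; simp
  have h20 : γ₂ 0 = m := by rw [hs₂ 0 ⟨le_rfl, ht₀.le⟩]; simp
  have hmU : m ∈ U := h10 ▸ hU₁ ⟨le_rfl, hτ₁.1⟩
  -- points of the two stopped paths other than `m` are in the open images
  have hmem₁ : ∀ t ∈ Icc 0 τ₁, t ≠ 0 → γ₁ t ∈ γ₁ '' Ioo 0 1 := fun t ht ht0 =>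
    ⟨t, ⟨lt_of_le_of_ne ht.1 (Ne.symm ht0), ht.2.trans_lt hτ₁.2⟩, rfl⟩
  have hmem₂ : ∀ t ∈ Icc 0 τ₂, t ≠ 0 → γ₂ t ∈ γ₂ '' Ioo 0 1 := fun t ht ht0 =>
    ⟨t, ⟨lt_of_le_of_ne ht.1 (Ne.symm ht0), ht.2.trans_lt hτ₂.2⟩, rfl⟩
  refine ⟨?_, ?_, ?_, ?_⟩
  · -- simple arc: glue the reversed `γ₂ [0, τ₂]` and `γ₁ [0, τ₁]` at `m`
    have hA₁ : IsSimpleArc (γ₁ '' Icc 0 τ₁) m (γ₁ τ₁) :=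
      h10 ▸ isSimpleArc_image_Icc hγ₁ hinj₁ le_rfl hτ₁.1 hτ₁.2.le
    have hA₂ : IsSimpleArc (γ₂ '' Icc 0 τ₂) (γ₂ τ₂) m :=
      h20 ▸ (isSimpleArc_image_Icc hγ₂ hinj₂ le_rfl hτ₂.1 hτ₂.2.le).symm
    refine hA₂.union hA₁ ?_
    rintro z ⟨⟨s, hs, rfl⟩, ⟨t, ht, hst⟩⟩
    by_cases hs0 : s = 0
    · rw [hs0, h20]; rfl
    by_cases ht0 : t = 0
    · rw [← hst, ht0, h10]; rfl
    exact absurd (hst ▸ hmem₁ t ht ht0 : γ₂ s ∈ γ₁ '' Ioo 0 1)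
      (Set.disjoint_right.1 hdisj (hmem₂ s hs hs0))
  · -- interior points
    rintro z ⟨hz, hzab⟩
    simp only [mem_insert_iff, mem_singleton_iff, not_or] at hzab
    rcases hz with ⟨s, hs, rfl⟩ | ⟨t, ht, rfl⟩
    · rcases hs.2.eq_or_lt with h | h
      · exact absurd (congrArg γ₂ h) hzab.1
      · exact hU₂ ⟨hs.1, h⟩
    · rcases ht.2.eq_or_lt with h | h
      · exact absurd (congrArg γ₁ h) hzab.2
      · exact hU₁ ⟨ht.1, h⟩
  · -- the forbidden set is met at most at `m`
    rintro z ⟨hz, hzX⟩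
    rcases hz with ⟨s, hs, rfl⟩ | ⟨t, ht, rfl⟩
    · by_cases hs0 : s = 0
      · rw [hs0, h20]; rfl
      · exact absurd hzX (Set.disjoint_left.1 hX (Or.inr (hmem₂ s hs hs0)))
    · by_cases ht0 : t = 0
      · rw [ht0, h10]; rfl
      · exact absurd hzX (Set.disjoint_left.1 hX (Or.inl (hmem₁ t ht ht0)))
  · -- the ball around `m`
    obtain ⟨ρ₀, hρ₀, hball₀⟩ := Metric.isOpen_iff.1 hU m hmU
    have hvn : 0 < ‖v‖ := norm_pos_iff.2 hv
    set μ : ℝ := min t₀ (min τ₁ τ₂) with hμ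
    have hμpos : 0 < μ := lt_min ht₀ (lt_min hτ₁.1 hτ₂.1)
    have hμt₀ : μ ≤ t₀ := min_le_left _ _
    have hμτ₁ : μ ≤ τ₁ := (min_le_right _ _).trans (min_le_left _ _)
    have hμτ₂ : μ ≤ τ₂ := (min_le_right _ _).trans (min_le_right _ _)
    set ρ : ℝ := min (min ρ₀ R) (c * μ * ‖v‖) / 2 with hρ
    have hmin : 0 < min (min ρ₀ R) (c * μ * ‖v‖) := lt_min (lt_min hρ₀ hR) (by positivity)
    have hρpos : 0 < ρ := by rw [hρ]; linarith
    have hρ₀' : ρ < ρ₀ := by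
      have := (min_le_left (min ρ₀ R) (c * μ * ‖v‖)).trans (min_le_left _ _)
      rw [hρ]; linarith
    have hρR : ρ < R := by
      have := (min_le_left (min ρ₀ R) (c * μ * ‖v‖)).trans (min_le_right _ _)
      rw [hρ]; linarith
    have hρμ : ρ < c * μ * ‖v‖ := by
      have := min_le_right (min ρ₀ R) (c * μ * ‖v‖)
      rw [hρ]; linarith
    refine ⟨ρ, hρpos, (Metric.ball_subset_ball hρ₀'.le).trans hball₀, ?_⟩
    ext z
    constructor
    · rintro ⟨hz, hzb⟩
      refine ⟨hzb, ?_⟩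
      rw [Metric.mem_ball] at hzb
      show inner ℝ (z - m) v = 0
      rcases hz with ⟨s, hs, rfl⟩ | ⟨t, ht, rfl⟩
      · rcases le_or_gt s t₀ with h | h
        · rw [hs₂ s ⟨hs.1, h⟩, show m - ((c * s : ℝ) : ℂ) * (Complex.I * v) - m =
            -(((c * s : ℝ) : ℂ) * (Complex.I * v)) by ring, inner_neg_left,
            inner_ofReal_mul_I_mul, neg_zero]
        · have := hR₂ s ⟨h.le, hs.2.trans hτ₂.2.le⟩
          linarith
      · rcases le_or_gt t t₀ with h | h
        · rw [hs₁ t ⟨ht.1, h⟩, show m + ((c * t : ℝ) : ℂ) * (Complex.I * v) - m =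
            ((c * t : ℝ) : ℂ) * (Complex.I * v) by ring, inner_ofReal_mul_I_mul]
        · have := hR₁ t ⟨h.le, ht.2.trans hτ₁.2.le⟩
          linarith
    · rintro ⟨hzb, hz0⟩
      refine ⟨?_, hzb⟩
      rw [Metric.mem_ball, dist_eq_norm] at hzb
      obtain ⟨θ, hθ, hnorm⟩ := exists_eq_ofReal_mul_I_mul_of_inner_eq_zero hv hz0
      rw [hnorm] at hzb
      -- the parameter of `z` on the straight piece
      have hθμ : |θ| < c * μ := by
        by_contra hle
        have hle' := not_lt.1 hle
        have : c * μ * ‖v‖ ≤ |θ| * ‖v‖ := by gcongr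
        linarith
      set t : ℝ := |θ| / c with ht
      have ht0 : 0 ≤ t := div_nonneg (abs_nonneg θ) hc.le
      have htμ : t < μ := by rw [ht, div_lt_iff₀ hc]; linarith
      have hct : c * t = |θ| := by rw [ht]; field_simp
      rcases le_or_gt 0 θ with hθ0 | hθ0
      · right
        refine ⟨t, ⟨ht0, (htμ.trans_le hμτ₁).le⟩, ?_⟩
        rw [hs₁ t ⟨ht0, (htμ.trans_le hμt₀).le⟩, hct, abs_of_nonneg hθ0, ← hθ]
        ring
      · left
        refine ⟨t, ⟨ht0, (htμ.trans_le hμτ₂).le⟩, ?_⟩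
        rw [hs₂ t ⟨ht0, (htμ.trans_le hμt₀).le⟩, hct, abs_of_neg hθ0, Complex.ofReal_neg,
          show m - -(θ : ℂ) * (Complex.I * v) = m + (θ : ℂ) * (Complex.I * v) by ring, ← hθ]
        ring

end Summit.CriticalPhenomena.CardyFormulaZ2.Theorems.CardySelfRefinement

end
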